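import Mathlib.Analysis.SpecialFunctions.Pow.Continuity
import Mathlib.Analysis.SpecialFunctions.Trigonometric.Basic
import Mathlib.MeasureTheory.Integral.IntegralEqImproper
import Mathlib.MeasureTheory.Integral.IntervalIntegral.Basic
import HarnessLib

/-!
# Elgindi's fundamental self-similar model: the kernel `K`, the operator `L₁₂`, the angular
weight `Γ` and the explicit profile `F_*`

Topic `Literature/Analysis/FluidPDE`. First file (everything **proved**, no named facts) of the
self-similar framework in which T. M. Elgindi, *Finite-time singularity formation for `C^{1,α}`
solutions to the incompressible Euler equations on `ℝ³`*, Ann. of Math. 194 (2021)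
(arXiv:1904.04795, `[Elgindi2021]`) and T. M. Elgindi, T.-E. Ghoul, N. Masmoudi, *On the
stability of self-similar blow-up for `C^{1,α}` solutions to the incompressible Euler equations
on `ℝ³`*, Camb. J. Math. 9 (2021) (arXiv:1910.14071, `[ElgindiGhoulMasmoudi2021]`) construct
and stabilise the `C^{1,α}` blow-up profile. It lies on the decomposition path of the named
fact `Literature.Analysis.FluidPDE.ElgindiGhoulMasmoudi2021_blowupSolution`
(`ElgindiAprioriBlowupProofs.lean`), whose self-similar core (Elgindi's profile
`F = F_* + α²g`, the Elgindi–Ghoul–Masmoudi stability theorem in the weighted spaces `𝓗ᵏ`) is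
written entirely in the objects below ("p." = chunk of the held texts).

In the variables `(R, θ)`, `R = ρ^α`, `θ = arctan(x₃/r) ∈ [0, π/2]` of the axisymmetric
swirl-free Euler equations ([Elgindi2021] §2.1, p. 8; [ElgindiGhoulMasmoudi2021] §2.2, p. 7) the
Biot–Savart law has the leading part `Ψ = (4α)⁻¹ sin(2θ) L₁₂(Ω) + lower order terms`
([Elgindi2021] §2.2, p. 9; [ElgindiGhoulMasmoudi2021] §2.3.1, p. 8) with

* `K(θ) = 3 sin θ cos² θ` ([Elgindi2021] §1.7.1, p. 7; [ElgindiGhoulMasmoudi2021] §1.7, p. 5),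
* `L₁₂(f)(z) = ∫_z^∞ ∫₀^{π/2} f(r, θ) K(θ)/r dθ dr` ([Elgindi2021] §1.7.2, p. 7;
  [ElgindiGhoulMasmoudi2021] Definition 1.7, p. 6: "`= ∫_z^∞ 3∫₀^{π/2} f(r,θ) sin θ cos² θ / r`"),

and dropping the transport terms leaves the *fundamental model* `∂ₜΩ = α⁻¹ L₁₂(Ω) Ω`
([Elgindi2021] §2.3, p. 9, and §4, p. 13), solved explicitly by self-similar profiles
`(1 − t)⁻¹ F_*(R/(1 − t), θ)` with `F_* ∝ (Γ(θ)/c) z/(1+z)²` for any angular factor `Γ` with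
`c = ∫₀^{π/2} K Γ ≠ 0` ([Elgindi2021] §4.2, Lemma 4.1, p. 13: the radial identity
`F_{*,rad} + z∂_zF_{*,rad} = F_{*,rad} ∫_z^∞ F_{*,rad}(ρ)/ρ dρ` for `F_{*,rad} = 2z/(1+z)²`). The
blow-up profile of the Euler equations is then `F = F_* + α² g` around

* `Γ(θ) = (sin θ cos² θ)^{α/3}` ([Elgindi2021] §1.7.1, p. 7, and §9, p. 30;
  [ElgindiGhoulMasmoudi2021] §1.7, p. 5), `c = ∫₀^{π/2} Γ K` ([Elgindi2021] §4.2, p. 14, and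
  §9, p. 30),
* `F_* = (Γ/c) · 4αz/(1+z)²` ([ElgindiGhoulMasmoudi2021] §2.3, p. 7: "`F = F_* + α²g`, where
  `F_* = (Γ/c) 4αz/(1+z)²`, `|g|_{𝓗ᵏ} ≤ C`"; [Elgindi2021] §9, p. 30, writes
  `F_* = α(Γ/c) 2z/(1+z)²` for the time-dilated equation `½∂ₜΩ + …` (first display of his §9;
  Lemma 4.1: `f = 2α(Γ/c)(1−t)⁻¹F_{*,rad}(r^α/(1−t))`, `F_{*,rad} = z/(1+z)²`), which is the same
  profile after the dilation; [ElgindiGhoulMasmoudi2021] §3.2, p. 10, quotes Elgindi's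
  normalisation `2α(Γ/c)y/(1+y)²`).

## What is proved

* positivity/continuity of `K`, `Γ`, and `c > 0` (`profileConst_pos`), the boundary vanishing
  `Γ(0) = Γ(π/2) = 0` (the profile vanishes on the symmetry plane and on the axis);
* **`L₁₂(F_*)(z) = 4α/(1+z)`** for `z ≥ 0` (`L12_fundamentalProfile`): the inner integral is
  `(4α/(1+r)²) c⁻¹ ∫ Γ K = 4α/(1+r)²`, and `∫_z^∞ 4α/(1+r)² dr = 4α/(1+z)`;
* the radial identity `F_* + z∂_z F_* = (2/(1+z)) F_*` (`fundamentalProfile_add_mul_deriv`;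
  the computation of [Elgindi2021] Lemma 4.1) and hence **`F_*` is a stationary profile of the
  fundamental model in self-similar variables**, `F_* + z∂_z F_* = (2α)⁻¹ L₁₂(F_*) F_*`
  (`fundamentalProfile_selfSimilar`; [Elgindi2021] §9, p. 30: "noting that
  `F_* + z∂_z F_* − α⁻¹ L₁₂(F_*) F_* = 0`" in the dilated normalisation, where `F_*` is half of
  ours and the identity reads the same after dividing by `2`,
  `fundamentalProfile_selfSimilar_dilated`); these are the leading-order identities
  `𝓡(Φ_F) = 2/(1+y) + O(α)`, `𝓡(Φ_ε) = (2α)⁻¹L₁₂(ε) + O(1)` of [ElgindiGhoulMasmoudi2021]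
  §2.3.1, p. 8;
* the peak value `F_*(1, θ) = α Γ(θ)/c` (`fundamentalProfile_one`), used downstream for the
  non-triviality `‖F‖_∞ > 0` of the profile.

## What is NOT here

The weighted spaces `𝓗ᵏ`, `𝓦^{l,∞}`, the linearised operators `𝓛`, `𝓛_Γ`, `𝓛_Γ^T`, `𝓜_F`,
the elliptic problem for `Φ`, the profile `F` itself (a named fact to come: [Elgindi2021] §9.5)
and the stability theorem ([ElgindiGhoulMasmoudi2021] Thm 2) — see the prover notes of
`ElgindiGhoulMasmoudi2021_blowupSolution` for the decomposition plan. Hardy's inequality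
`|L₁₂(f)w|_{L²} ≤ 4|fw|_{L²}` ([Elgindi2021] Lemma 5.4) is not needed yet.

Mathlib/tree search (`lean search 'L12|L₁₂|fundamentalProfile|Elgindi' --decl`): nothing on
Elgindi's framework in Mathlib or the tree (only the physical-variable facts of
`ElgindiBlowup*.lean`, `ElgindiAprioriBlowupProofs.lean` and the rescaling bookkeeping of
`DynamicRescalingBKM.lean`). Used from Mathlib: `Real.rpow`, `intervalIntegral`,
`intervalIntegral_pos_of_pos_on`, `integral_Ioi_of_hasDerivAt_of_nonneg'`,
`integral_const_mul`, `setIntegral_congr_fun`, `HasDerivAt.div`.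
-/

noncomputable section

open MeasureTheory Set Filter Real intervalIntegral
open _root_.Topology

namespace Literature.Analysis.FluidPDE

namespace Elgindi

/-! ### The kernel `K`, the angular weight `Γ` and the normalisation constant `c` -/

/-- The kernel `K(θ) = 3 sin θ cos² θ` of the operator `L₁₂` (Elgindi, Ann. of Math. 194 (2021),
§1.7.1; Elgindi–Ghoul–Masmoudi, Camb. J. Math. 9 (2021), §1.7): `sin θ cos² θ` spans the kernel
of the adjoint of the angular operator `L₀Ψ = −∂_θθΨ + ∂_θ(tan θ Ψ) − 6Ψ` (Elgindi, §2.2). [cite: Elgindi2021, §1.7.1 (p. 7 of arXiv:1904.04795): K(θ) = 3 sin θ cos² θ] -/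
def kernelK (θ : ℝ) : ℝ :=
  3 * Real.sin θ * Real.cos θ ^ 2

/-- The angular weight `Γ(θ) = Γ_α(θ) = (sin θ cos² θ)^{α/3}` of Elgindi's profile (Elgindi
2021, §1.7.1 and §9, the display after "where `F_* = …`"; Elgindi–Ghoul–Masmoudi 2021, §1.7).
For `θ` outside `[0, π]` the base may be negative and `Real.rpow` takes its junk branch; only
`θ ∈ [0, π/2]` is ever used. [cite: Elgindi2021, §1.7.1 (p. 7) and §9 (p. 30): Γ(θ) = (sin θ cos² θ)^{α/3}] -/
def angularWeight (α θ : ℝ) : ℝ :=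
  (Real.sin θ * Real.cos θ ^ 2) ^ (α / 3)

/-- The normalisation constant `c = c_α = ∫₀^{π/2} Γ(θ) K(θ) dθ` of the profile `F_*` (Elgindi
2021, §4.2: "`c = ∫ K(θ)Γ(θ) dθ`", and §9: "`c = ∫₀^{π/2} Γ(θ)K(θ) dθ`"; Elgindi–Ghoul–Masmoudi
2021, §1.7: "a normalization constant", `1/10 ≤ c ≤ 10`). [cite: Elgindi2021, §9 (p. 30): c = ∫₀^{π/2} Γ K; §4.2 (p. 13–14)] -/
def profileConst (α : ℝ) : ℝ :=
  ∫ θ in (0 : ℝ)..(π / 2), kernelK θ * angularWeight α θ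

/-- `K` is continuous. [folklore] -/
theorem continuous_kernelK : Continuous kernelK := by
  unfold kernelK
  fun_prop

/-- `K > 0` on the open quarter `0 < θ < π/2`. [folklore] -/
theorem kernelK_pos {θ : ℝ} (hθ : θ ∈ Ioo 0 (π / 2)) : 0 < kernelK θ := by
  have hs : 0 < Real.sin θ := Real.sin_pos_of_pos_of_lt_pi hθ.1 (by linarith [hθ.2, pi_pos])
  have hc : 0 < Real.cos θ := Real.cos_pos_of_mem_Ioo ⟨by linarith [hθ.1, pi_pos], hθ.2⟩
  unfold kernelK
  positivity

/-- `sin θ cos² θ ≥ 0` on the closed quarter `0 ≤ θ ≤ π/2`. [folklore] -/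
theorem sin_mul_cos_sq_nonneg {θ : ℝ} (hθ : θ ∈ Icc 0 (π / 2)) :
    0 ≤ Real.sin θ * Real.cos θ ^ 2 :=
  mul_nonneg (Real.sin_nonneg_of_nonneg_of_le_pi hθ.1 (by linarith [hθ.2, pi_pos])) (sq_nonneg _)

/-- `K ≥ 0` on the closed quarter `0 ≤ θ ≤ π/2`. [folklore] -/
theorem kernelK_nonneg {θ : ℝ} (hθ : θ ∈ Icc 0 (π / 2)) : 0 ≤ kernelK θ := by
  have := sin_mul_cos_sq_nonneg hθ
  unfold kernelK
  nlinarith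

/-- `Γ ≥ 0` on the closed quarter. [folklore] -/
theorem angularWeight_nonneg (α : ℝ) {θ : ℝ} (hθ : θ ∈ Icc 0 (π / 2)) :
    0 ≤ angularWeight α θ :=
  Real.rpow_nonneg (sin_mul_cos_sq_nonneg hθ) _

/-- `Γ > 0` on the open quarter. [folklore] -/
theorem angularWeight_pos (α : ℝ) {θ : ℝ} (hθ : θ ∈ Ioo 0 (π / 2)) : 0 < angularWeight α θ := by
  have hs : 0 < Real.sin θ := Real.sin_pos_of_pos_of_lt_pi hθ.1 (by linarith [hθ.2, pi_pos])
  have hc : 0 < Real.cos θ := Real.cos_pos_of_mem_Ioo ⟨by linarith [hθ.1, pi_pos], hθ.2⟩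
  exact Real.rpow_pos_of_pos (by positivity) _

/-- The profile vanishes on the symmetry plane `θ = 0`: `Γ(0) = 0` for `α ≠ 0`. [folklore] -/
theorem angularWeight_zero {α : ℝ} (hα : α ≠ 0) : angularWeight α 0 = 0 := by
  simp [angularWeight, Real.zero_rpow (div_ne_zero hα three_ne_zero)]

/-- The profile vanishes on the axis `θ = π/2`: `Γ(π/2) = 0` for `α ≠ 0`. [folklore] -/
theorem angularWeight_pi_div_two {α : ℝ} (hα : α ≠ 0) : angularWeight α (π / 2) = 0 := by
  simp [angularWeight, Real.zero_rpow (div_ne_zero hα three_ne_zero)]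

/-- `Γ_α` is continuous for `α ≥ 0`. [folklore] -/
theorem continuous_angularWeight {α : ℝ} (hα : 0 ≤ α) : Continuous (angularWeight α) := by
  unfold angularWeight
  exact (by fun_prop : Continuous fun θ : ℝ => Real.sin θ * Real.cos θ ^ 2).rpow_const
    fun _ => Or.inr (div_nonneg hα zero_le_three)

/-- The integrand `K Γ` of `c` is continuous for `α ≥ 0`. [folklore] -/
theorem continuous_kernelK_mul_angularWeight {α : ℝ} (hα : 0 ≤ α) :
    Continuous fun θ => kernelK θ * angularWeight α θ :=
  continuous_kernelK.mul (continuous_angularWeight hα)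

/-- **`c > 0`**: the normalisation constant is the integral of a continuous function which is
positive on `(0, π/2)` (Elgindi 2021, §1.7.1: "`1/10 ≤ c ≤ 10`"; only positivity is recorded). [folklore] -/
theorem profileConst_pos {α : ℝ} (hα : 0 ≤ α) : 0 < profileConst α := by
  unfold profileConst
  refine intervalIntegral_pos_of_pos_on
    ((continuous_kernelK_mul_angularWeight hα).intervalIntegrable _ _)
    (fun θ hθ => mul_pos (kernelK_pos hθ) (angularWeight_pos α hθ)) (by positivity)

/-- `c` as a set integral over the open quarter `(0, π/2)`. [folklore] -/
theorem profileConst_eq_setIntegral (α : ℝ) :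
    profileConst α = ∫ θ in Ioo 0 (π / 2), kernelK θ * angularWeight α θ := by
  unfold profileConst
  rw [intervalIntegral.integral_of_le (by positivity), integral_Ioc_eq_integral_Ioo]

/-! ### The operator `L₁₂` -/

/-- **The operator `L₁₂`**: `L₁₂(f)(z) = ∫_z^∞ ∫₀^{π/2} f(r, θ) K(θ)/r dθ dr`, `K = 3 sin θ cos² θ`
(Elgindi–Ghoul–Masmoudi 2021, Definition 1.7: "`L₁₂(f)(z) = ∫_z^∞ 3∫₀^{π/2} f(r,θ) sin θ cos² θ / r
dθ dr`"; Elgindi 2021, §1.7.2 and (2.x)/(4.2)), for functions `f` of `(r, θ) ∈ [0, ∞) × [0, π/2]`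
(curried, `f r θ`). Bochner integrals over `Ioi z` and `Ioo 0 (π/2)`: junk value `0` where the
iterated integral diverges (it converges absolutely for `f w sin(2θ)^{-η/2} ∈ L²`, i.e. on `𝓗⁰`,
since `K/(r w) ∈ L²`). [cite: ElgindiGhoulMasmoudi2021, Definition 1.7 (p. 6 of arXiv:1910.14071)]
[cite: Elgindi2021, §1.7.2 (p. 7)] -/
def L12 (f : ℝ → ℝ → ℝ) (z : ℝ) : ℝ :=
  ∫ r in Ioi z, ∫ θ in Ioo 0 (π / 2), f r θ * kernelK θ / r

/-- Unfolding `L₁₂`. [folklore] -/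
theorem L12_def (f : ℝ → ℝ → ℝ) (z : ℝ) :
    L12 f z = ∫ r in Ioi z, ∫ θ in Ioo 0 (π / 2), f r θ * kernelK θ / r :=
  rfl

/-! ### The explicit profile `F_*` -/

/-- **The fundamental profile** `F_*(z, θ) = (Γ(θ)/c) · 4αz/(1+z)²` (Elgindi–Ghoul–Masmoudi 2021,
§2.3: "Recall that `F = F_* + α²g`, where `F_* = F_*(α) = (Γ/c) 4αz/(1+z)²`, `|g|_{𝓗ᵏ} ≤ C`";
Elgindi 2021, §9: `F_* = α(Γ/c) 2z/(1+z)²` for the time-dilated equation (9.1) `½∂ₜΩ + …`, and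
§4.2: the explicit self-similar solutions `(Γ/c)(1−t)⁻¹F_{*,rad}(·/(1−t))`, `F_{*,rad} = 2z/(1+z)²`,
of the fundamental model). Curried in `(z, θ)`; meaningful for `z ≥ 0`, `θ ∈ [0, π/2]`. [cite: ElgindiGhoulMasmoudi2021, §2.3 (p. 7): F_* = (Γ/c)·4αz/(1+z)²]
[cite: Elgindi2021, §9 (p. 30) and §4.2 (p. 13–14)] -/
def fundamentalProfile (α : ℝ) (z θ : ℝ) : ℝ :=
  angularWeight α θ / profileConst α * (4 * α * z / (1 + z) ^ 2)

/-- `F_*` vanishes at the blow-up point `z = 0`. [folklore] -/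
theorem fundamentalProfile_zero_left (α θ : ℝ) : fundamentalProfile α 0 θ = 0 := by
  simp [fundamentalProfile]

/-- `F_*` vanishes on the symmetry plane `θ = 0` (`α ≠ 0`). [folklore] -/
theorem fundamentalProfile_zero_right {α : ℝ} (hα : α ≠ 0) (z : ℝ) :
    fundamentalProfile α z 0 = 0 := by
  simp [fundamentalProfile, angularWeight_zero hα]

/-- `F_*` vanishes on the axis `θ = π/2` (`α ≠ 0`). [folklore] -/
theorem fundamentalProfile_pi_div_two {α : ℝ} (hα : α ≠ 0) (z : ℝ) :
    fundamentalProfile α z (π / 2) = 0 := by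
  simp [fundamentalProfile, angularWeight_pi_div_two hα]

/-- **Peak value** `F_*(1, θ) = α Γ(θ)/c` (the radial factor `4z/(1+z)²` attains its maximum `1`
at `z = 1`); with `Γ > 0` inside the quarter this is the non-triviality of the profile. [folklore] -/
theorem fundamentalProfile_one (α θ : ℝ) :
    fundamentalProfile α 1 θ = α * angularWeight α θ / profileConst α := by
  simp only [fundamentalProfile]
  ring

/-- `F_* ≥ 0` on `z ≥ 0`, `θ ∈ [0, π/2]`, for `α ≥ 0`. [folklore] -/
theorem fundamentalProfile_nonneg {α : ℝ} (hα : 0 ≤ α) {z : ℝ} (hz : 0 ≤ z) {θ : ℝ}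
    (hθ : θ ∈ Icc 0 (π / 2)) : 0 ≤ fundamentalProfile α z θ := by
  have h1 := angularWeight_nonneg α hθ
  have h2 := (profileConst_pos hα).le
  unfold fundamentalProfile
  positivity

/-- `F_* > 0` inside the quarter, `z > 0`, for `α > 0`. [folklore] -/
theorem fundamentalProfile_pos {α : ℝ} (hα : 0 < α) {z : ℝ} (hz : 0 < z) {θ : ℝ}
    (hθ : θ ∈ Ioo 0 (π / 2)) : 0 < fundamentalProfile α z θ := by
  have h1 := angularWeight_pos α hθ
  have h2 := profileConst_pos hα.le
  unfold fundamentalProfile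
  positivity

/-! ### `L₁₂(F_*) = 4α/(1+z)` -/

/-- The angular integral of `F_* K / r` at radius `r ≠ 0`:
`∫₀^{π/2} F_*(r, θ) K(θ)/r dθ = 4α/(1+r)²` (pull out the radial factor; `∫ Γ K = c`). [folklore] -/
theorem integral_fundamentalProfile_mul_kernelK_div {α : ℝ} (hα : 0 ≤ α) {r : ℝ} (hr : r ≠ 0) :
    ∫ θ in Ioo 0 (π / 2), fundamentalProfile α r θ * kernelK θ / r = 4 * α / (1 + r) ^ 2 := by
  have hc : profileConst α ≠ 0 := (profileConst_pos hα).ne'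
  have key : ∀ θ, fundamentalProfile α r θ * kernelK θ / r =
      (4 * α / (1 + r) ^ 2 / profileConst α) * (kernelK θ * angularWeight α θ) := by
    intro θ
    simp only [fundamentalProfile]
    field_simp
  simp_rw [key]
  rw [MeasureTheory.integral_const_mul, ← profileConst_eq_setIntegral]
  field_simp

/-- **`L₁₂(F_*)(z) = 4α/(1+z)` for `z ≥ 0`** (the computation of Elgindi 2021, §4.2, proof of
Lemma 4.1, `∫_z^∞ F_{*,rad}(ρ)/ρ dρ = 2/(1+z)` for `F_{*,rad} = 2z/(1+z)²`, with the angular factor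
integrated out, `c⁻¹∫ Γ K = 1`; behind Elgindi–Ghoul–Masmoudi 2021, §2.3.1: `𝓡(Φ_F) = 2/(1+y) + O(α)`). [cite: Elgindi2021, §4.2 Lemma 4.1 and its proof (p. 13 of arXiv:1904.04795); §9 (p. 30)] -/
theorem L12_fundamentalProfile {α : ℝ} (hα : 0 ≤ α) {z : ℝ} (hz : 0 ≤ z) :
    L12 (fundamentalProfile α) z = 4 * α / (1 + z) := by
  rw [L12_def]
  have h1 : ∫ r in Ioi z, ∫ θ in Ioo 0 (π / 2), fundamentalProfile α r θ * kernelK θ / r =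
      ∫ r in Ioi z, (4 * α) * ((1 + r) ^ 2)⁻¹ := by
    refine setIntegral_congr_fun measurableSet_Ioi fun r hr => ?_
    rw [integral_fundamentalProfile_mul_kernelK_div hα (hz.trans_lt hr).ne']
    ring
  rw [h1, MeasureTheory.integral_const_mul]
  -- `∫_z^∞ (1+r)⁻² dr = (1+z)⁻¹`, by the fundamental theorem of calculus on `[z, ∞)`
  have hd : ∀ r ∈ Ici z, HasDerivAt (fun r : ℝ => -(1 + r)⁻¹) (((1 + r) ^ 2)⁻¹) r := by
    intro r hr
    have hr1 : (1 + r) ≠ 0 := by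
      have : 0 ≤ r := hz.trans hr
      positivity
    exact ((((hasDerivAt_id' r).const_add 1).fun_inv hr1).fun_neg).congr_deriv (by ring)
  have ht : Tendsto (fun r : ℝ => 1 + r) atTop atTop :=
    tendsto_atTop_add_const_left _ 1 tendsto_id
  have h3 : Tendsto (fun r : ℝ => (1 + r)⁻¹) atTop (𝓝 0) := tendsto_inv_atTop_zero.comp ht
  have h4 : Tendsto (fun r : ℝ => -(1 + r)⁻¹) atTop (𝓝 0) := by simpa using h3.neg
  rw [integral_Ioi_of_hasDerivAt_of_nonneg' hd (fun r _ => by positivity) h4]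
  have hz1 : (1 + z) ≠ 0 := by positivity
  field_simp
  ring

/-! ### `F_*` is a stationary profile of the fundamental model -/

/-- The radial derivative of `F_*`: `∂_z F_*(z, θ) = (Γ(θ)/c) · 4α(1 − z)/(1+z)³` (`z ≠ −1`). [folklore] -/
theorem hasDerivAt_fundamentalProfile (α θ : ℝ) {z : ℝ} (hz : 1 + z ≠ 0) :
    HasDerivAt (fun z => fundamentalProfile α z θ)
      (angularWeight α θ / profileConst α * (4 * α * (1 - z) / (1 + z) ^ 3)) z := by
  have hnum : HasDerivAt (fun z : ℝ => 4 * α * z) (4 * α) z := by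
    simpa using (hasDerivAt_id' z).const_mul (4 * α)
  have hden : HasDerivAt (fun z : ℝ => (1 + z) ^ 2) (2 * (1 + z)) z := by
    simpa using ((hasDerivAt_id' z).const_add 1).fun_pow 2
  have hq : HasDerivAt (fun z => fundamentalProfile α z θ)
      (angularWeight α θ / profileConst α *
        ((4 * α * (1 + z) ^ 2 - 4 * α * z * (2 * (1 + z))) / ((1 + z) ^ 2) ^ 2)) z :=
    (hnum.fun_div hden (pow_ne_zero 2 hz)).const_mul (angularWeight α θ / profileConst α)
  refine hq.congr_deriv ?_
  field_simp
  ring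

/-- **The radial identity** `F_* + z∂_z F_* = (2/(1+z)) F_*` (`z ≠ −1`) (Elgindi 2021, proof of
Lemma 4.1: "`F_{*,rad} + z∂_zF_{*,rad} = 2z/(1+z)² + 2z/(1+z)² − 4z²/(1+z)³ = 4z/(1+z)³`"); with
`L₁₂(F_*) = 4α/(1+z)` this is the profile equation of the fundamental model. [cite: Elgindi2021, §4.2, proof of Lemma 4.1 (p. 13)] -/
theorem fundamentalProfile_add_mul_deriv (α θ : ℝ) {z : ℝ} (hz : 1 + z ≠ 0) :
    fundamentalProfile α z θ + z * deriv (fun z => fundamentalProfile α z θ) z =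
      2 / (1 + z) * fundamentalProfile α z θ := by
  rw [(hasDerivAt_fundamentalProfile α θ hz).deriv]
  simp only [fundamentalProfile]
  field_simp
  ring

/-- **`F_*` is a stationary self-similar profile of the fundamental model**: for `z > 0`,
`F_* + z∂_z F_* = (2α)⁻¹ L₁₂(F_*)(z) F_*` (Elgindi 2021, §4.2 Lemma 4.1: the fundamental model
"possesses a family of self similar solutions `f = 2α(Γ/c)(1−t)⁻¹F_{*,rad}(r^α/(1−t))`,
`F_{*,rad} = z/(1+z)²` … whenever `c ≠ 0` and `α > 0`", through the identity
`F_{*,rad} + z∂_zF_{*,rad} = F_{*,rad}∫_z^∞ F_{*,rad}(ρ)/ρ dρ`; §9: "noting that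
`F_* + z∂_zF_* − α⁻¹L₁₂(F_*)F_* = 0`" for the dilated profile `F_*/2`, see
`fundamentalProfile_selfSimilar_dilated`; Elgindi–Ghoul–Masmoudi 2021, §2.3.1: the leading part
`(2α)⁻¹L₁₂` of the stretching coefficient, `𝓡(Φ_F) = 2/(1+y) + O(α)`). [cite: Elgindi2021, §4.2 Lemma 4.1 (p. 13) and §9 (p. 30)]
[cite: ElgindiGhoulMasmoudi2021, §2.3.1 (p. 8 of arXiv:1910.14071)] -/
theorem fundamentalProfile_selfSimilar {α : ℝ} (hα : 0 < α) {z : ℝ} (hz : 0 < z) (θ : ℝ) :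
    fundamentalProfile α z θ + z * deriv (fun z => fundamentalProfile α z θ) z =
      (2 * α)⁻¹ * L12 (fundamentalProfile α) z * fundamentalProfile α z θ := by
  have hz1 : 1 + z ≠ 0 := by positivity
  rw [fundamentalProfile_add_mul_deriv α θ hz1, L12_fundamentalProfile hα.le hz.le]
  field_simp
  ring

/-- The same identity in Elgindi's time-dilated normalisation (Ann. of Math. 2021, §9, first
display `½∂ₜΩ + U(Ψ)∂_θΩ + … = 𝓡(Ψ)Ω` and the display "`F_* + z∂_zF_* − α⁻¹L₁₂(F_*)F_* = 0`"):
the half profile `F_*ᴱ = F_*/2 = α(Γ/c) 2z/(1+z)²` satisfies `F_*ᴱ + z∂_zF_*ᴱ = α⁻¹ L₁₂(F_*ᴱ) F_*ᴱ`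
(`z > 0`). [cite: Elgindi2021, §9 (p. 30): F_* + z∂_zF_* − α⁻¹L₁₂(F_*)F_* = 0] -/
theorem fundamentalProfile_selfSimilar_dilated {α : ℝ} (hα : 0 < α) {z : ℝ} (hz : 0 < z) (θ : ℝ) :
    fundamentalProfile α z θ / 2 + z * deriv (fun z => fundamentalProfile α z θ / 2) z =
      α⁻¹ * L12 (fun r θ => fundamentalProfile α r θ / 2) z * (fundamentalProfile α z θ / 2) := by
  have hz1 : 1 + z ≠ 0 := by positivity
  -- `L₁₂` is linear: `L₁₂(F_*/2) = L₁₂(F_*)/2 = 2α/(1+z)`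
  have hL : L12 (fun r θ => fundamentalProfile α r θ / 2) z = 2 * α / (1 + z) := by
    rw [L12_def]
    have h1 : ∫ r in Ioi z, ∫ θ in Ioo 0 (π / 2), fundamentalProfile α r θ / 2 * kernelK θ / r =
        ∫ r in Ioi z, 2⁻¹ * ∫ θ in Ioo 0 (π / 2), fundamentalProfile α r θ * kernelK θ / r := by
      refine setIntegral_congr_fun measurableSet_Ioi fun r _ => ?_
      rw [← MeasureTheory.integral_const_mul]
      congr 1
      funext θ
      ring
    rw [h1, MeasureTheory.integral_const_mul, ← L12_def, L12_fundamentalProfile hα.le hz.le]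
    ring
  have hd : deriv (fun z => fundamentalProfile α z θ / 2) z =
      deriv (fun z => fundamentalProfile α z θ) z / 2 := by
    rw [((hasDerivAt_fundamentalProfile α θ hz1).div_const 2).deriv,
      (hasDerivAt_fundamentalProfile α θ hz1).deriv]
  rw [hL, hd]
  have key := fundamentalProfile_add_mul_deriv α θ hz1
  have e : fundamentalProfile α z θ / 2 + z * (deriv (fun z => fundamentalProfile α z θ) z / 2) =
      (fundamentalProfile α z θ + z * deriv (fun z => fundamentalProfile α z θ) z) / 2 := by ring
  rw [e, key]
  field_simp

end Elgindi

end Literature.Analysis.FluidPDE
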